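import Literature.NumberTheory.EllipticCurves.BurungaleCastellaSkinner2025.BDPMainConjectureAtTrivialCharacter
import Summits.BirchSwinnertonDyer.Rank1Residual.Partition.MainConjecturesControlPublishedClass
import Summits.BirchSwinnertonDyer.Rank1Residual.Partition.MainConjecturesControlJSWClass
import Summits.BirchSwinnertonDyer.Rank1Residual.Partition.AnticyclotomicControlJSWEmbAt
import Summits.BirchSwinnertonDyer.Rank1Residual.Partition.AnticyclotomicLogConjugate
import HarnessLib

/-!
# The (IMC∘BDP)ᵍ link of the irreducible rank-one rows FROM A PUBLISHED FACT:
# Burungale–Castella–Skinner 2025 Thm. 1.2.4 (b) ∘ CGLS 2022 Thm. 5.1.3 — rows C2 (`r ≤ 1`) and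
# C3-ordinary (`p ≥ 5`) of the partition now stand on NAMED LITERATURE FACTS ONLY

HONEST FRAMING (cell `b2b-bsdres`, run/shared/lean/b2b/bsd-rank1-residual/; page 1 of every file):
the goal is to DELETE the COMBINATION-SHAPED residual classes — to produce a Lean theorem "BSD_p
formula for every rank `≤ 1` curve in class `C`" assembled STRICTLY from published theorems — so
that the remainder becomes exactly the CONSTRUCTION-SHAPED classes, which are TYPED, not attempted;
this is not "finishing BSD". Every published theorem enters as one of the tree's existing named
Literature facts `(h : <Fact>)` (a `def … : Prop` vendored with its cite, D-0014; nothing asserted, no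
new fact, no `sorry`). Unit `b2b-bsdres-lit-glue` (GLUE seat), gen 6, File G; companion of the
Literature file `BurungaleCastellaSkinner2025/BDPMainConjectureAtTrivialCharacter.lean` (this gen,
sized ask S15 of lit-cgls `CGLS-GV-TYPING.md` §13.5).

## What this file does

Gens 3–5 typed the rank-one deduction "cyclotomic MC + anticyclotomic control (CTL)ᵍ +
(IMC≥∘BDP)ᵍ ⇒ `BSD(E,p)`" with the two anticyclotomic links as Summits-side SHAPES
(`X11b.ControlOnTreeGoodAt`, `X11b.IMCLowerWaldspurgerOnTreeGoodAt`); gen 5 / lit-cgls fed (CTL)ᵍ from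
CGLS 2022 Thm. 5.1.1 (A170) off the anomalous line, gen 6 Files A–E from JSW 2017 Thm. 3.3.1 (A174)
at every pair. The last typed input of rows C2 / C3-ordinary was `hLA` = (IMC≥∘BDP)ᵍ. Its printed
source at a good ordinary `p > 3` with (sur) is Burungale–Castella–Skinner 2025 Thm. 1.2.4 (b)
composed with the BDP formula at `𝟙` (CGLS 2022 Thm. 5.1.3) — vendored this gen as the Literature
fact `BurungaleCastellaSkinner2025.thm124b_thm513_generator_constantCoeff` (the (sur) twin of
lit-cgls's Eisenstein composite A173). This file PROVES:

* §0 `X11b.exists_involutive_comp_eq` — two embeddings `ι, ι' : K →+* ℚ_p` of a quadratic field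
  differ by an involution `σ` of `K` (`K/ℚ` is Galois of order 2; Mathlib `AlgHom.restrictNormal'`).
  With lit-cgls's S13 `padicLogOrd_comp_eq_of_rank_one` this is the σ-bridge between the two printed
  letters (CGLS/BCS: module strict at `v̄`, log along `ι ↦ v`; JSW/Castella: log at the strict prime).
* §1 `X11b.imcWaldspurgerOnTreeGoodAt_of_thm124b` — the cell's EQUALITY link
  `IMCWaldspurgerOnTreeGoodAt p κ v̄ γ ι P` (CGLS letter) from the fact, at every datum of BCS 1.2.4 with
  a Manin-unit parametrisation (`p ∤ c_E`), GIVEN one generator of `ch_Λ(X_Gr)` with non-zero constant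
  term; §2 supplies that generator from CGLS Thm. 5.1.1 (`…_of_thm511`, needs `a_p ≢ 1 (mod p)`) or from
  JSW Thm. 3.3.1 at the embedding `embAt v̄` (`…_of_thm331`, needs (irr_K), NO anomaly restriction).
* §3 `X11b.imcWaldspurgerOnTreeGoodAt_inducedPlace_of_thm124b_of_thm331` — the SAME link in the JSW
  letter `IMCWaldspurgerOnTreeGoodAt p κ (inducedPlace ι) γ ι P`: BCS at the conjugate embedding
  `embAt v̄ = ι ∘ σ` (§0) and `ord_p log_{ι∘σ} P = ord_p log_ι P` in rank one (S13).
* §4 at a classical Heegner datum of an `r_an = 1` curve (rank one and `#Ш(E/K)[p^∞] < ∞` over `K` by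
  GZK + descent, `P_K` non-torsion by Gross–Zagier): the `hLA` binders of gen 5
  (`…IMCLowerWaldspurgerOnTreeGoodAt p κ v̄ γ ι P`, CGLS letter) and of gen 6 File C
  (`… (inducedPlace ι) γ ι P`, JSW letter) DISCHARGED.
* the class theorems with `hLA` GONE (rows C2 both letters, C3-ordinary `p ≥ 5`) are in the sibling
  `Partition/MainConjecturesIrreducibleBDPClass.lean` (size split).

So for row C2 (= BCS 2025 Cor. 1.3.1 in print) the cell now holds a kernel-checked proof of the
printed deduction "Thm. 1.1.2 (b) [cyclotomic IMC] + Thm. 1.2.4 (b) [anticyclotomic IMC] + BDP formula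
+ JSW 3.3.1 [control] + GZK ⇒ BSD_p" (BCS p. 4), every input a named, cited Literature fact, modulo
the two explicit binders (irr_K) (⇐ (sur) in print, not a tree theorem — File B docstring) and
`p ∤ ∏c_ℓ · c_E` (Manin: Mazur, `hMaz`; Tamagawa: the class restriction `htam0` of gen 3).
Registry flags inherited, not decided here: `BCS25-IMC-equiv@BSTW` (T-BCS / A148) on every use of
BCS 2025; reading flag `BCS-124-XGr-reading` offered with the fact.

References: [BurungaleCastellaSkinner2025] Thm. 1.1.2 (b), Thm. 1.2.4 (b), Cor. 1.3.1 and its proof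
(p. 4); [CastellaGrossiLeeSkinner2022] Thm. 5.1.1, Thm. 5.1.3; [JetchevSkinnerWan2017] Thm. 3.3.1,
§7.4.1; [Castella2018] Thm. 3.2, §5; HOME/b2b-bsdres-lit-glue/GLUE.md GEN 6 ADDENDUM;
HOME/b2b-bsdres-lit-cgls/CGLS-GV-TYPING.md §12–§13.
-/

set_option autoImplicit false

noncomputable section

open scoped Classical

open WeierstrassCurve NumberField IsDedekindDomain Literature.NumberTheory.EllipticCurves
  Literature.NumberTheory.EllipticCurves.ModularForms Literature.NumberTheory.Automorphic
  Literature.NumberTheory.EllipticCurves.Rank1Residual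
  Literature.NumberTheory.EllipticCurves.YanZhu2026
  Literature.NumberTheory.EllipticCurves.BurungaleCastellaSkinner2025
  Literature.NumberTheory.EllipticCurves.BurungaleKobayashiOta2024
  Literature.NumberTheory.EllipticCurves.CastellaGrossiLeeSkinner2022
  Literature.NumberTheory.EllipticCurves.JetchevSkinnerWan2017
  Summit.BirchSwinnertonDyer.BirchSwinnertonDyer.Theorems.Rank1ResidualX1Defs

namespace Summit.BirchSwinnertonDyer.Rank1Residual

namespace X11b

/-! ### §0 Two `p`-adic embeddings of a quadratic field differ by an involution -/

section Galois

variable {K : Type} [Field K] [NumberField K] {p : ℕ} [Fact p.Prime]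

/-- **Two embeddings `ι, ι' : K ↪ ℚ_p` of a quadratic field `K` differ by an involution of `K`**:
there is `σ : K →+* K` with `σ ∘ σ = id` and `ι ∘ σ = ι'`. (`K/ℚ` is Galois with group of order
`[K:ℚ] = 2`; `σ` is the restriction of `ι'` to the normal extension `K` relative to the
`K`-algebra structure `ι` on `ℚ_p` — Mathlib `AlgHom.restrictNormal'` — and every element of a group
of order `2` is an involution.) For `K` imaginary quadratic with `p` split and `ι' ≠ ι`, `σ` is complex
conjugation and `ι ∘ σ` induces the conjugate prime. [folklore] -/
theorem exists_involutive_comp_eq (h2 : Module.finrank ℚ K = 2) (ι ι' : K →+* ℚ_[p]) :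
    ∃ σ : K →+* K, (∀ x, σ (σ x) = x) ∧ ι.comp σ = ι' := by
  haveI : Algebra.IsQuadraticExtension ℚ K := ⟨h2⟩
  letI : Algebra K ℚ_[p] := ι.toAlgebra
  haveI : IsScalarTower ℚ K ℚ_[p] := IsScalarTower.of_algebraMap_eq' (Subsingleton.elim _ _)
  set τ : K ≃ₐ[ℚ] K := AlgHom.restrictNormal' ι'.toRatAlgHom K with hτ
  have hcard : Nat.card (K ≃ₐ[ℚ] K) = 2 := by rw [IsGalois.card_aut_eq_finrank, h2]
  have hτ2 : τ * τ = 1 := by rw [← pow_two, ← hcard]; exact pow_card_eq_one'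
  refine ⟨(τ : K →+* K), fun x ↦ ?_, ?_⟩
  · have h := congrArg (fun e : K ≃ₐ[ℚ] K ↦ e x) hτ2
    simpa [AlgEquiv.mul_apply] using h
  · ext x
    have h : ι ((ι'.toRatAlgHom.restrictNormal K) x) = ι' x :=
      AlgHom.restrictNormal_commutes ι'.toRatAlgHom K x
    simpa [hτ, AlgHom.restrictNormal'] using h

end Galois

/-! ### §1 `IMCWaldspurgerOnTreeGoodAt` (CGLS letter) from the BCS ∘ BDP fact, given a generator -/

section IMC

variable {W : WeierstrassCurve ℚ} [W.IsElliptic] [W.IsGloballyMinimal] {p : ℕ} [Fact p.Prime]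
  {K : Type} [Field K] [NumberField K]

/-- **`X11b.IMCWaldspurgerOnTreeGoodAt p κ v̄ γ ι P` FROM Burungale–Castella–Skinner 2025 Thm. 1.2.4 (b)
∘ CGLS 2022 Thm. 5.1.3**, at every datum of the fact — `p > 3` good ordinary with (sur), `K` imaginary
quadratic with (Heeg) for `N = N_E`, (spl), (disc) `D_K` odd `≠ −3`, `ι : K ↪ ℚ_p` inducing `v`,
`v̄ ∋ p` the other (STRICT) prime, `κ` anticyclotomic with generator `γ`, `P = P_K` the Heegner point of
`(Dt, H, ιC)` — for a parametrisation with `p ∤ c_E` (then the Manin term of the fact vanishes and its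
valuation is LITERALLY the predicate's), GIVEN one generator `G` of `ch_Λ(X_Gr)` with `G(0) ≠ 0`
(supplied by a control theorem, §2). Through the defeq bridge (`AcSelmer.hasCharValuationAt_iff_literature`,
`padicLogOrd_eq_literature`). The (sur) twin of lit-cgls's `imcWaldspurgerOnTreeGoodAt_of_display54_of_thm511`.
[cite: BurungaleCastellaSkinner2025, Thm. 1.2.4 (b) (p. 3) and proof of Cor. 1.3.1 (p. 4)]
[cite: CastellaGrossiLeeSkinner2022, Thm. 5.1.3] [cite: Castella2018, §5 (eq:IMC+BDP) (arXiv:1704.06608 p. 12)] -/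
theorem imcWaldspurgerOnTreeGoodAt_of_thm124b (h124 : thm124b_thm513_generator_constantCoeff)
    (hp : 3 < p) (hord : GoodOrd W p) (hsurj : Surj W p) (hK : IsImaginaryQuadratic K)
    (hodd : Odd (NumberField.discr K)) (h3 : NumberField.discr K ≠ -3)
    {N : ℕ} [NeZero N] (hN : W.conductorNorm ℤ = N) (hHN : SatisfiesHeegnerHypothesis N K)
    (hHp : SatisfiesHeegnerHypothesis p K) (ι : K →+* ℚ_[p]) (v vbar : HeightOneSpectrum (𝓞 K))
    (hv : ∀ x : 𝓞 K, x ∈ v.asIdeal ↔ ‖ι (x : K)‖ < 1)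
    (hvbar : ((p : ℕ) : 𝓞 K) ∈ vbar.asIdeal) (hne : vbar ≠ v)
    (κ : ZpExtension K p) (hκ : κ.IsAnticyclotomic)
    (γ : Field.absoluteGaloisGroup K) [Fact (κ.IsTopGenerator γ)]
    (Dt : ModularParametrizationData W N) (hc : ¬ (p : ℤ) ∣ Dt.c)
    (H : HeegnerDatum N (NumberField.discr K)) (ιC : K →+* ℂ) (P : (W.baseChange K).toAffine.Point)
    (hP : WeierstrassCurve.Affine.Point.map ιC.toRatAlgHom P = heegnerPointComplex Dt H)
    (G : IwasawaAlgebra p)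
    (hG : Literature.NumberTheory.EllipticCurves.Castella2018.AcSelmer.XAc.charIdeal (W.baseChange K) p
      κ vbar ∅ γ = Ideal.span {G})
    (hG0 : PowerSeries.constantCoeff G ≠ 0) :
    IMCWaldspurgerOnTreeGoodAt p κ vbar γ ι P := by
  have hHN' : SatisfiesHeegnerHypothesis (W.conductorNorm ℤ) K := by rw [hN]; exact hHN
  obtain ⟨n, hn, hval⟩ := hasCharValuationAt_of_thm124b h124 hp hord hsurj K hK hHN' hHp hodd h3 ι v
    vbar hv hvbar hne κ hκ γ Dt H ιC P hP G hG hG0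
  have hc0 : padicValInt p Dt.c = 0 := padicValInt.eq_zero_of_not_dvd hc
  refine ⟨n, (AcSelmer.hasCharValuationAt_iff_literature _ p κ vbar ∅ γ n).mpr hn, ?_⟩
  rw [padicLogOrd_eq_literature]
  omega

/-! ### §2 The generator from a published control theorem -/

/-- **(IMC∘BDP)ᵍ, CGLS letter, from BCS 1.2.4 (b) ∘ CGLS 5.1.3 + CGLS 5.1.1** (the generator with
`𝓕(0) ≠ 0` from Thm. 5.1.1 = A170, whose hypothesis `E(ℚ_p)[p] = 0` is `a_p ≢ 1 (mod p)` at a good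
`p ≥ 3` — `LocalTorsion.localTorsion_eq_zero_of_good_of_not_dvd`; its `rank_ℤ E(K) = 1`,
`#Ш(E/K)[p^∞] < ∞`, `P` non-torsion are carried). Off the anomalous line.
[cite: BurungaleCastellaSkinner2025, Thm. 1.2.4 (b)] [cite: CastellaGrossiLeeSkinner2022, Thm. 5.1.1, Thm. 5.1.3] -/
theorem imcWaldspurgerOnTreeGoodAt_of_thm124b_of_thm511 (h124 : thm124b_thm513_generator_constantCoeff)
    (h511 : thm511_anticyclotomicControl)
    (hp : 3 < p) (hord : GoodOrd W p) (hsurj : Surj W p) (hna : ¬ (p : ℤ) ∣ W.frobeniusTrace p - 1)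
    (hK : IsImaginaryQuadratic K) (hodd : Odd (NumberField.discr K)) (h3 : NumberField.discr K ≠ -3)
    {N : ℕ} [NeZero N] (hN : W.conductorNorm ℤ = N) (hHN : SatisfiesHeegnerHypothesis N K)
    (hHp : SatisfiesHeegnerHypothesis p K) (ι : K →+* ℚ_[p]) (v vbar : HeightOneSpectrum (𝓞 K))
    (hv : ∀ x : 𝓞 K, x ∈ v.asIdeal ↔ ‖ι (x : K)‖ < 1)
    (hvbar : ((p : ℕ) : 𝓞 K) ∈ vbar.asIdeal) (hne : vbar ≠ v)
    (κ : ZpExtension K p) (hκ : κ.IsAnticyclotomic)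
    (γ : Field.absoluteGaloisGroup K) [Fact (κ.IsTopGenerator γ)]
    (Dt : ModularParametrizationData W N) (hc : ¬ (p : ℤ) ∣ Dt.c)
    (H : HeegnerDatum N (NumberField.discr K)) (ιC : K →+* ℂ) (P : (W.baseChange K).toAffine.Point)
    (hP : WeierstrassCurve.Affine.Point.map ιC.toRatAlgHom P = heegnerPointComplex Dt H)
    (hrk : (W.baseChange K).mordellWeilRank = 1)
    (hfinp : Finite (AddCommGroup.primaryComponent (W.baseChange K).sha p))
    (hPinf : ¬ IsOfFinAddOrder P) :
    IMCWaldspurgerOnTreeGoodAt p κ vbar γ ι P := by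
  have hHN' : SatisfiesHeegnerHypothesis (W.conductorNorm ℤ) K := by rw [hN]; exact hHN
  have hEp : ∀ Q : (W.baseChange ℚ_[p]).toAffine.Point, p • Q = 0 → Q = 0 :=
    LocalTorsion.localTorsion_eq_zero_of_good_of_not_dvd W p (by omega) hord.1 hna
  obtain ⟨-, F, hF, hF0, -⟩ := h511 W p (by omega) hord K hK hHp hHN' ι v vbar hv hvbar hne κ hκ γ hEp
    hrk hfinp P hPinf
  exact imcWaldspurgerOnTreeGoodAt_of_thm124b h124 hp hord hsurj hK hodd h3 hN hHN hHp ι v vbar hv hvbar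
    hne κ hκ γ Dt hc H ιC P hP F hF hF0

/-- **(IMC∘BDP)ᵍ, CGLS letter, from BCS 1.2.4 (b) ∘ CGLS 5.1.3 + JSW 3.3.1** — NO anomaly restriction:
the generator with `𝓕(0) ≠ 0` of `ch_Λ(X_ac)` for the module STRICT AT `v̄` comes from
Jetchev–Skinner–Wan 2017 Thm. 3.3.1 (A174) applied at THE embedding `embAt v̄ : K ↪ K_v̄ = ℚ_p` (which
induces `v̄`: `mem_asIdeal_iff_norm_embAt_lt_one`; `v̄` has degree one as `p` splits); JSW's module
does not depend on the embedding and its valuation formula is not used here. Hypothesis (irr_K) of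
JSW carried (`hirrK`). [cite: BurungaleCastellaSkinner2025, Thm. 1.2.4 (b)]
[cite: CastellaGrossiLeeSkinner2022, Thm. 5.1.3] [cite: JetchevSkinnerWan2017, Thm. 3.3.1] -/
theorem imcWaldspurgerOnTreeGoodAt_of_thm124b_of_thm331 (h124 : thm124b_thm513_generator_constantCoeff)
    (h331 : thm331_anticyclotomicControl)
    (hp : 3 < p) (hord : GoodOrd W p) (hsurj : Surj W p)
    (hK : IsImaginaryQuadratic K) (hodd : Odd (NumberField.discr K)) (h3 : NumberField.discr K ≠ -3)
    {N : ℕ} [NeZero N] (hN : W.conductorNorm ℤ = N) (hHN : SatisfiesHeegnerHypothesis N K)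
    (hHp : SatisfiesHeegnerHypothesis p K) (hirrK : (W.baseChange K).HasIrreducibleModPGaloisRep p)
    (ι : K →+* ℚ_[p]) (v vbar : HeightOneSpectrum (𝓞 K))
    (hv : ∀ x : 𝓞 K, x ∈ v.asIdeal ↔ ‖ι (x : K)‖ < 1)
    (hvbar : ((p : ℕ) : 𝓞 K) ∈ vbar.asIdeal) (hne : vbar ≠ v)
    (κ : ZpExtension K p) (hκ : κ.IsAnticyclotomic)
    (γ : Field.absoluteGaloisGroup K) [Fact (κ.IsTopGenerator γ)]
    (Dt : ModularParametrizationData W N) (hc : ¬ (p : ℤ) ∣ Dt.c)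
    (H : HeegnerDatum N (NumberField.discr K)) (ιC : K →+* ℂ) (P : (W.baseChange K).toAffine.Point)
    (hP : WeierstrassCurve.Affine.Point.map ιC.toRatAlgHom P = heegnerPointComplex Dt H)
    (hrk : (W.baseChange K).mordellWeilRank = 1)
    (hfinp : Finite (AddCommGroup.primaryComponent (W.baseChange K).sha p))
    (hPinf : ¬ IsOfFinAddOrder P) :
    IMCWaldspurgerOnTreeGoodAt p κ vbar γ ι P := by
  have hHN' : SatisfiesHeegnerHypothesis (W.conductorNorm ℤ) K := by rw [hN]; exact hHN
  -- `v̄` has degree one (`p` splits in the quadratic `K`), so `embAt v̄ : K ↪ ℚ_p` induces `v̄`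
  have hsplit : SplitsIn K p := hHp p Fact.out (dvd_refl p)
  obtain ⟨he, hf⟩ := degreeOne_of_splitsIn hK.1 hsplit hvbar
  obtain ⟨-, F, hF, hF0, -⟩ := h331 W p (by omega) hord.1 K hK hHp hHN' hirrK
    (embAt K p vbar hvbar he hf) vbar (mem_asIdeal_iff_norm_embAt_lt_one vbar hvbar he hf) κ hκ γ hrk
    hfinp P hPinf
  exact imcWaldspurgerOnTreeGoodAt_of_thm124b h124 hp hord hsurj hK hodd h3 hN hHN hHp ι v vbar hv hvbar
    hne κ hκ γ Dt hc H ιC P hP F hF hF0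

/-! ### §3 The JSW letter: module strict at the induced prime, log along the same embedding -/

/-- **(IMC∘BDP)ᵍ in the JSW / Castella letter `IMCWaldspurgerOnTreeGoodAt p κ (inducedPlace ι) γ ι P`
from BCS 1.2.4 (b) ∘ CGLS 5.1.3 + JSW 3.3.1**, for EVERY embedding `ι : K ↪ ℚ_p`, in rank one. Let
`v = inducedPlace ι` and `w ≠ v` the other prime above `p` (`exists_other_prime`); BCS ∘ BDP at the
embedding `embAt w` (inducing `w`), strict prime `v`, gives `ord_p 𝓖(0) = 2·(ord_p(1 − a_p + p) − 1 +
ord_p log_{embAt w} P)` for every generator `𝓖` of `ch_Λ(X_ac(κ, v))` with `𝓖(0) ≠ 0` — one exists by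
JSW 3.3.1 at `(ι, v)` —, and `embAt w = ι ∘ σ` for an involution `σ` of `K` (§0), so
`ord_p log_{embAt w} P = ord_p log_ι P` (lit-cgls S13 `padicLogOrd_comp_eq_of_rank_one`: `σ_* P = ±P +
torsion` in rank one, `p ≠ 2`). This discharges the reading note `CGLS-CTL-log-prime` between the two
printed letters in the kernel, on the locus of the theorems.
[cite: BurungaleCastellaSkinner2025, Thm. 1.2.4 (b) (p. 3)] [cite: CastellaGrossiLeeSkinner2022, Thm. 5.1.3]
[cite: JetchevSkinnerWan2017, Thm. 3.3.1, §2.3.2 (p. 7)] [cite: Castella2018, Thm. 2.3, §5 (eq:IMC+BDP)] -/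
theorem imcWaldspurgerOnTreeGoodAt_inducedPlace_of_thm124b_of_thm331
    (h124 : thm124b_thm513_generator_constantCoeff) (h331 : thm331_anticyclotomicControl)
    (hp : 3 < p) (hord : GoodOrd W p) (hsurj : Surj W p)
    (hK : IsImaginaryQuadratic K) (hodd : Odd (NumberField.discr K)) (h3 : NumberField.discr K ≠ -3)
    {N : ℕ} [NeZero N] (hN : W.conductorNorm ℤ = N) (hHN : SatisfiesHeegnerHypothesis N K)
    (hHp : SatisfiesHeegnerHypothesis p K) (hirrK : (W.baseChange K).HasIrreducibleModPGaloisRep p)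
    (ι : K →+* ℚ_[p]) (κ : ZpExtension K p) (hκ : κ.IsAnticyclotomic)
    (γ : Field.absoluteGaloisGroup K) [Fact (κ.IsTopGenerator γ)]
    (Dt : ModularParametrizationData W N) (hc : ¬ (p : ℤ) ∣ Dt.c)
    (H : HeegnerDatum N (NumberField.discr K)) (ιC : K →+* ℂ) (P : (W.baseChange K).toAffine.Point)
    (hP : WeierstrassCurve.Affine.Point.map ιC.toRatAlgHom P = heegnerPointComplex Dt H)
    (hrk : (W.baseChange K).mordellWeilRank = 1)
    (hfinp : Finite (AddCommGroup.primaryComponent (W.baseChange K).sha p))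
    (hPinf : ¬ IsOfFinAddOrder P) :
    IMCWaldspurgerOnTreeGoodAt p κ (inducedPlace ι) γ ι P := by
  have hHN' : SatisfiesHeegnerHypothesis (W.conductorNorm ℤ) K := by rw [hN]; exact hHN
  -- the other prime `w` above `p`, of degree one, and THE embedding at it
  obtain ⟨w, hw, hwne⟩ := exists_other_prime hHp (inducedPlace ι) (natCast_mem_inducedPlace ι)
  have hsplit : SplitsIn K p := hHp p Fact.out (dvd_refl p)
  obtain ⟨he, hf⟩ := degreeOne_of_splitsIn hK.1 hsplit hw
  set ιw : K →+* ℚ_[p] := embAt K p w hw he hf with hιw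
  -- a generator with non-zero constant term of the module strict at `v = inducedPlace ι`, from JSW
  obtain ⟨-, F, hF, hF0, -⟩ := h331 W p (by omega) hord.1 K hK hHp hHN' hirrK ι (inducedPlace ι)
    (mem_inducedPlace_iff ι) κ hκ γ hrk hfinp P hPinf
  -- BCS ∘ BDP at the embedding `ιw` (inducing `w`), strict prime `inducedPlace ι`
  obtain ⟨n, hn, hval⟩ := hasCharValuationAt_of_thm124b h124 hp hord hsurj K hK hHN' hHp hodd h3 ιw w
    (inducedPlace ι) (mem_asIdeal_iff_norm_embAt_lt_one w hw he hf) (natCast_mem_inducedPlace ι)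
    (fun h ↦ hwne h.symm) κ hκ γ Dt H ιC P hP F hF hF0
  -- `ιw = ι ∘ σ` for an involution `σ`; the log valuations agree in rank one
  obtain ⟨σ, hσ, hισ⟩ := exists_involutive_comp_eq hK.1 ι ιw
  have hlog : Literature.NumberTheory.EllipticCurves.padicLogOrd W p ιw P = padicLogOrd W p ι P := by
    rw [← hισ, ← padicLogOrd_eq_literature]
    exact padicLogOrd_comp_eq_of_rank_one W p (by omega) σ hσ ι hrk P hPinf
  have hc0 : padicValInt p Dt.c = 0 := padicValInt.eq_zero_of_not_dvd hc
  refine ⟨n, (AcSelmer.hasCharValuationAt_iff_literature _ p κ (inducedPlace ι) ∅ γ n).mpr hn, ?_⟩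
  rw [hlog] at hval
  omega

end IMC

/-! ### §4 The `hLA` binders of the class theorems at a classical Heegner datum, DISCHARGED -/

section Datum

variable (W : WeierstrassCurve ℚ) [W.IsElliptic] [W.IsGloballyMinimal] (p : ℕ) [Fact p.Prime]
  (N : ℕ) [NeZero N] (K : Type) [Field K] [NumberField K]
  (Dt : ModularParametrizationData W N) (H : HeegnerDatum N (NumberField.discr K)) (ιC : K →+* ℂ)
  (P : (W.baseChange K).toAffine.Point)

/-- **Gen 5's `hLA` (CGLS letter) at a classical Heegner datum with `P_K` non-torsion, from BCS
1.2.4 (b) ∘ CGLS 5.1.3 + CGLS 5.1.1** (off the anomalous line): `rank_ℤ E(K) = 1` and `#Ш(E/K) < ∞`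
by Kolyvagin (`hKo`, from the non-torsion Heegner point); `d_K < −4` gives `d_K ≠ −3`.
[cite: BurungaleCastellaSkinner2025, Thm. 1.2.4 (b), proof of Cor. 1.3.1 (p. 4)]
[cite: CastellaGrossiLeeSkinner2022, Thm. 5.1.1, Thm. 5.1.3] [cite: Kolyvagin1990, Thm. A] -/
theorem imcLowerWaldspurgerOnTreeGoodAt_of_heegner_of_thm124b_of_thm511
    (h124 : thm124b_thm513_generator_constantCoeff) (h511 : thm511_anticyclotomicControl)
    (hKo : kolyvagin N W K)
    (hp : 3 < p) (hord : GoodOrd W p) (hsurj : Surj W p) (hna : ¬ (p : ℤ) ∣ W.frobeniusTrace p - 1)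
    (hN : W.conductorNorm ℤ = N) (hK : IsImaginaryQuadratic K)
    (hodd : Odd (NumberField.discr K)) (hlt : NumberField.discr K < -4)
    (hHN : SatisfiesHeegnerHypothesis N K) (hHp : SatisfiesHeegnerHypothesis p K)
    (hP : WeierstrassCurve.Affine.Point.map ιC.toRatAlgHom P = heegnerPointComplex Dt H)
    (hc : ¬ (p : ℤ) ∣ Dt.c) (hPinf : ¬ IsOfFinAddOrder P) {κ : ZpExtension K p} (hκ : κ.IsAnticyclotomic)
    {γ : Field.absoluteGaloisGroup K} [Fact (κ.IsTopGenerator γ)] (ι : K →+* ℚ_[p])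
    (vbar : HeightOneSpectrum (𝓞 K)) (hvbar : ((p : ℕ) : 𝓞 K) ∈ vbar.asIdeal)
    (hne : vbar ≠ inducedPlace ι) :
    IMCLowerWaldspurgerOnTreeGoodAt p κ vbar γ ι P := by
  obtain ⟨hrk, hsha⟩ := hKo hK hHN ⟨Dt, H, ιC, hP⟩ hPinf
  haveI : Finite (W.baseChange K).sha := hsha
  exact imcLowerWaldspurgerOnTreeGoodAt_of_imcWaldspurgerOnTreeGoodAt
    (imcWaldspurgerOnTreeGoodAt_of_thm124b_of_thm511 h124 h511 hp hord hsurj hna hK hodd (by omega) hN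
      hHN hHp ι (inducedPlace ι) vbar (mem_inducedPlace_iff ι) hvbar hne κ hκ γ Dt hc H ιC P hP hrk
      inferInstance hPinf)

/-- **Gen 6 File C's `hLA` (JSW letter) at a classical Heegner datum with `P_K` non-torsion, from BCS
1.2.4 (b) ∘ CGLS 5.1.3 + JSW 3.3.1 + the σ-bridge** — every pair `p > 3` good ordinary with (sur),
anomalous or not; (irr_K) carried; rank one and finite `Ш` over `K` by Kolyvagin (`hKo`).
[cite: BurungaleCastellaSkinner2025, Thm. 1.2.4 (b), proof of Cor. 1.3.1 (p. 4)]
[cite: JetchevSkinnerWan2017, Thm. 3.3.1, §7.4.1] [cite: Kolyvagin1990, Thm. A] -/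
theorem imcLowerWaldspurgerOnTreeGoodAt_inducedPlace_of_heegner_of_thm124b_of_thm331
    (h124 : thm124b_thm513_generator_constantCoeff) (h331 : thm331_anticyclotomicControl)
    (hKo : kolyvagin N W K)
    (hp : 3 < p) (hord : GoodOrd W p) (hsurj : Surj W p)
    (hirrK : (W.baseChange K).HasIrreducibleModPGaloisRep p)
    (hN : W.conductorNorm ℤ = N) (hK : IsImaginaryQuadratic K)
    (hodd : Odd (NumberField.discr K)) (hlt : NumberField.discr K < -4)
    (hHN : SatisfiesHeegnerHypothesis N K) (hHp : SatisfiesHeegnerHypothesis p K)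
    (hP : WeierstrassCurve.Affine.Point.map ιC.toRatAlgHom P = heegnerPointComplex Dt H)
    (hc : ¬ (p : ℤ) ∣ Dt.c) (hPinf : ¬ IsOfFinAddOrder P) {κ : ZpExtension K p} (hκ : κ.IsAnticyclotomic)
    {γ : Field.absoluteGaloisGroup K} [Fact (κ.IsTopGenerator γ)] (ι : K →+* ℚ_[p]) :
    IMCLowerWaldspurgerOnTreeGoodAt p κ (inducedPlace ι) γ ι P := by
  obtain ⟨hrk, hsha⟩ := hKo hK hHN ⟨Dt, H, ιC, hP⟩ hPinf
  haveI : Finite (W.baseChange K).sha := hsha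
  exact imcLowerWaldspurgerOnTreeGoodAt_of_imcWaldspurgerOnTreeGoodAt
    (imcWaldspurgerOnTreeGoodAt_inducedPlace_of_thm124b_of_thm331 h124 h331 hp hord hsurj hK hodd
      (by omega) hN hHN hHp hirrK ι κ hκ γ Dt hc H ιC P hP hrk inferInstance hPinf)

end Datum

end X11b

end Summit.BirchSwinnertonDyer.Rank1Residual

end
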